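import Literature.AlgebraicGeometry.Motives.FamiliesVHSExteriorPower
import Literature.AlgebraicGeometry.Motives.HodgeStructureTensorPolarization
import Literature.AlgebraicGeometry.Motives.HodgeTensorFactsHolds
import Literature.AlgebraicGeometry.Motives.FamiliesVHSComap
import Mathlib.LinearAlgebra.Dual.BaseChange
import Mathlib.LinearAlgebra.Dual.Lemmas
import Mathlib.Algebra.Category.ModuleCat.ChangeOfRings
import HarnessLib

/-!
# The dual `D^∨` of the data of a polarized variation of Hodge structure: the dual local systems `V_ℤ^∨`, `V^∨`, the comparison
# `V_ℤ^∨ ⊗ ℚ ≅ V^∨`, the fibrewise dual Hodge structures of weight `−k` and the inverse polarization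

Topic `Literature/AlgebraicGeometry/Motives` (namespaces `Literature.AlgebraicGeometry.Motives.LocalSystem`, `….Motives.VHSData`), lane `lit-hodgefound`
(seat `p08`, row g56-#10).  DEFINITIONS WITH BODIES (`LocalSystem.dual`, `VHSData.toRatLinear`, the comparison `VHSData.dualRatIsoApp` ∕ `dualRatIso`,
`VHSData.dual`) and their API; no named fact, no instance, no notation (D-0026 net debt `0`).  Companion of `Motives/FamiliesVHSExteriorPower` (`⋀ᵈ D`) and
`Motives/FamiliesVHSTensor` (`D₁ ⊗ D₂`): with it the variations `Hom(D₁, D₂) = D₁^∨ ⊗ D₂`, `End(D) = D^∨ ⊗ D` of the later literature become available.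

PRINTED SOURCES.  P. Deligne, *Équations différentielles à points singuliers réguliers*, LNM 163 (1970), I.1: local systems on `S` «forment une
`⊗`-catégorie … avec objet unité, `Hom` interne et dual» — the dual local system has fibre the dual module and transport the CONTRAGREDIENT
`ᵗ(γ_*)⁻¹`.  P. Griffiths, *Periods of integrals on algebraic manifolds III*, Publ. Math. IHÉS 38 (1970), §1 ∕ W. Schmid, *Variation of Hodge
structure*, Invent. Math. 22 (1973), §2: variations of Hodge structure are stable under duals, `Hom` and `⊗`.  P. Deligne, *Théorie de Hodge II*,
1.1.6–1.1.7 (the dual Hodge structure, weight `−k`), 2.1.15 (polarizations); B. Moonen, *Families of motives and the Mumford–Tate conjecture*, §2.1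
(«`HS^pol` is closed under duals»: the inverse form `Q^∨(φ, ψ) = Q(θ⁻¹φ, θ⁻¹ψ)`, `θ = Q♭`).  N. Bourbaki, *Algebra I*, Ch. II §5 no. 4 ∕ Mathlib
`IsBaseChange.dual`: for a finitely generated free module, taking duals commutes with base change, `ℚ ⊗ Hom_ℤ(M, ℤ) ⥲ Hom_ℚ(ℚ ⊗ M, ℚ)`.

* §1 **`LocalSystem.dual V`** — the dual of a local system of `R`-modules (`R` commutative): fibre `Hom_R(V_x, R)` (Mathlib `Module.Dual`), transport
  along `g` the transpose of the transport along `g⁻¹` (`(V.map (Groupoid.inv g)).dualMap`); `rfl` API (`dual_fiber`, `dual_transport_apply`: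
  `(γ · φ)(v) = φ(γ⁻¹ · v)`).
* §2 **`VHSData.toRatLinear`, `isBaseChange_toRatLinear`** — the comparison `V_ℤ,x → V_x` of a VHS datum as a `ℤ`-linear map, and the fact that it
  is a BASE CHANGE along `ℤ → ℚ` (Mathlib `IsBaseChange`, from `ratIso : V_x ≅ V_ℤ,x ⊗ ℚ`).
* §3 **the comparison `V_ℤ,x^∨ ⊗ ℚ ⥲ V_x^∨`**: `dualRatIsoApp x` = Mathlib's `IsBaseChange.toDualBaseChange` for the base change of §2
  (`(1 ⊗ φ)(toRat u) = φ(u)`), its naturality along `Π₁(S)` (checked on `1 ⊗ φ` and on the `ℚ`-spanning image of `V_ℤ,y`, `IsBaseChange.algHom_ext`),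
  the natural isomorphism `dualRatIso`.
* §4 **`VHSData.dual D : VHSData S (−k)`** — `V_ℤ^∨`, `V^∨`, the comparison of §3, on each fibre the dual Hodge structure (the tree's `HodgeStructure.dual`,
  weight `−k`; separation ∕ opposedness by `hodgeTensorFacts_holds`) polarized by the INVERSE FORM (the tree's `Polarization.dual`, `Q^∨ = Q.dualForm`),
  which is flat because the transports of `D` are isometries (`dualForm_comp_eq`); the integral fibres `Hom(V_ℤ,s, ℤ)` are finitely generated free.
* §5 API: `dual_VZ`, `dual_V`, `dual_hodge`, `dual_form_form`, `dual_V_transport_apply`, `dual_VZ_transport_apply`, **`dual_toRat_apply`**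
  (`toRat^∨(φ)(toRat u) = φ(u)`: the comparison of `D^∨` evaluates integral functionals on integral vectors integrally).

HONEST SCOPE: as for every `VHSData`, holomorphy and transversality are not recorded; the Hodge-theoretic input (the dual of a Hodge structure is a
Hodge structure, the inverse form polarizes it) is the tree's (`Motives/HodgeTensor`, `Motives/HodgeStructureTensorPolarization`,
`Motives/MumfordTateInvariantsDualForm`).  `Hom` and `End` variations are not in this file.

## References

* [Deligne1970] P. Deligne, *Équations différentielles à points singuliers réguliers*, LNM 163 (1970), I.1.
* [Griffiths1970] P. Griffiths, *Periods of integrals on algebraic manifolds III*, Publ. Math. IHÉS 38 (1970), §1.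
* [Schmid1973] W. Schmid, *Variation of Hodge structure: the singularities of the period mapping*, Invent. Math. 22 (1973), §2.
* [DeligneHodgeII1971] P. Deligne, *Théorie de Hodge II*, Publ. Math. IHÉS 40 (1971), 1.1.6–1.1.7, 2.1.15.
* [Moonen2017FamiliesMotives] B. Moonen, *Families of motives and the Mumford–Tate conjecture*, Milan J. Math. 85 (2017), §2.1.
* [BourbakiAlgebraI1989] N. Bourbaki, *Algebra I*, Ch. II §5 no. 4 (duality and extension of scalars for finitely generated free modules).
-/

noncomputable section

open CategoryTheory
open scoped TensorProduct ChangeOfRings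

universe u

namespace Literature.AlgebraicGeometry.Motives

/-! ## §1 The dual local system -/

namespace LocalSystem

variable {R : Type u} [CommRing R] {S : Type u} [TopologicalSpace S]

/-- **The dual `V^∨` of a local system** of `R`-modules (`R` commutative): the functor `Π₁(S) ⥤ Mod_R` with value `Hom_R(V_x, R)` at `x` and, along
`g : x ⟶ y`, the CONTRAGREDIENT transport `φ ↦ φ ∘ (g⁻¹)_*` — the transpose of `V` applied to the inverse of `g` in the groupoid (Deligne 1970, I.1:
local systems form a `⊗`-category with duals, operations fibrewise). [cite: Deligne1970, I.1] -/
def dual (V : LocalSystem R S) : LocalSystem R S where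
  obj x := ModuleCat.of R (Module.Dual R (V.obj x))
  map g := ModuleCat.ofHom (V.map (Groupoid.inv g)).hom.dualMap
  map_id x := by
    ext : 1
    rw [ModuleCat.hom_ofHom, Groupoid.inv_eq_inv, IsIso.inv_id, V.map_id, ModuleCat.hom_id, ModuleCat.hom_id]
    rfl
  map_comp f g := by
    ext : 1
    rw [ModuleCat.hom_ofHom, ModuleCat.hom_comp, ModuleCat.hom_ofHom, ModuleCat.hom_ofHom, Groupoid.inv_eq_inv, IsIso.inv_comp,
      ← Groupoid.inv_eq_inv, ← Groupoid.inv_eq_inv, V.map_comp, ModuleCat.hom_comp]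
    rfl

/-- The value of `V^∨` at a point of the fundamental groupoid is the dual module. [cite: Deligne1970, I.1] -/
@[simp] theorem dual_obj (V : LocalSystem R S) (x : FundamentalGroupoid S) : V.dual.obj x = ModuleCat.of R (Module.Dual R (V.obj x)) := rfl

/-- The fibre of `V^∨` at `s` is `Hom_R(V_s, R)`. [cite: Deligne1970, I.1] -/
theorem dual_fiber (V : LocalSystem R S) (s : S) : V.dual.fiber s = ModuleCat.of R (Module.Dual R (V.fiber s)) := rfl

/-- `V^∨` on a morphism `g` is the transpose of `V` on `g⁻¹`. [cite: Deligne1970, I.1] -/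
theorem dual_map_hom (V : LocalSystem R S) {x y : FundamentalGroupoid S} (g : x ⟶ y) :
    (V.dual.map g).hom = (V.map (Groupoid.inv g)).hom.dualMap := rfl

/-- **Transport in `V^∨` is the contragredient**: `γ_* φ = φ ∘ (γ⁻¹)_*`. [cite: Deligne1970, I.1] -/
theorem dual_transport (V : LocalSystem R S) {s t : S} (γ : Path.Homotopic.Quotient s t) :
    V.dual.transport γ = (V.transport γ.symm).dualMap := rfl

/-- `γ_* φ = φ ∘ γ⁻¹_*` for `φ ∈ V_s^∨` (so `(γ_* φ)(v) = φ(γ⁻¹_* v)`). [cite: Deligne1970, I.1] -/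
theorem dual_transport_apply (V : LocalSystem R S) {s t : S} (γ : Path.Homotopic.Quotient s t) (φ : Module.Dual R (V.fiber s)) :
    V.dual.transport γ φ = φ ∘ₗ V.transport γ.symm := rfl

/-- The transport of `V` along `γ⁻¹` undoes the transport along `γ` (all morphisms of `Π₁(S)` are invertible; the tree's `transportEquiv`).
[cite: Deligne1970, I.1.1] -/
theorem transport_symm_apply_transport (V : LocalSystem R S) {s t : S} (γ : Path.Homotopic.Quotient s t) (v : V.fiber s) :
    V.transport γ.symm (V.transport γ v) = v :=
  (V.transportEquiv γ).symm_apply_apply v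

/-- The transport of `V` along `γ` undoes the transport along `γ⁻¹`. [cite: Deligne1970, I.1.1] -/
theorem transport_apply_transport_symm (V : LocalSystem R S) {s t : S} (γ : Path.Homotopic.Quotient s t) (v : V.fiber t) :
    V.transport γ (V.transport γ.symm v) = v :=
  (V.transportEquiv γ).apply_symm_apply v

end LocalSystem

namespace VHSData

variable {S : Type} [TopologicalSpace S] {k : ℤ} (D : VHSData S k)

/-! ## §2 `toRat` as a `ℤ`-linear base change `V_ℤ,x → V_x` -/

/-- **The comparison `V_ℤ,x → V_x` as a `ℤ`-linear map** into the rational fibre (a `ℚ`-vector space regarded as a `ℤ`-module); it is the tree's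
additive `toRat`. [cite: Schmid1973, §2 (`V_ℚ = V_ℤ ⊗ ℚ`)] -/
def toRatLinear (x : FundamentalGroupoid S) : D.VZ.obj x →ₗ[ℤ] D.V.obj x where
  toFun := D.toRat x.as
  map_add' := map_add (D.toRat x.as)
  map_smul' m u := map_intCast_smul (D.toRat x.as) ℤ ℤ m u

/-- `toRatLinear` is `toRat`. [cite: Schmid1973, §2] -/
@[simp] theorem toRatLinear_apply (x : FundamentalGroupoid S) (u : D.VZ.obj x) : D.toRatLinear x u = D.toRat x.as u := rfl

/-- **`V_x` is the base change of `V_ℤ,x` along `ℤ → ℚ` through `toRat`** (Mathlib `IsBaseChange`; from the comparison isomorphism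
`ratIso : V_x ≅ V_ℤ,x ⊗ ℚ`, `1 ⊗ u ↦ toRat u`). [cite: Schmid1973, §2 (`V_ℚ = V_ℤ ⊗ ℚ`)] -/
theorem isBaseChange_toRatLinear (x : FundamentalGroupoid S) : IsBaseChange ℚ (D.toRatLinear x) :=
  IsBaseChange.of_equiv (D.ratIso.app x).toLinearEquiv.symm fun _ => rfl

/-! ## §3 The comparison `V_ℤ,x^∨ ⊗ ℚ ⥲ V_x^∨` -/

/-- **The comparison `Hom(V_ℤ,x, ℤ) ⊗ ℚ ≅ Hom_ℚ(V_x, ℚ)`** (component at `x`, in `ModuleCat ℚ`): Mathlib's `IsBaseChange.toDualBaseChange` — for the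
finitely generated free `V_ℤ,x`, duality commutes with the base change `V_x = V_ℤ,x ⊗ ℚ` (Bourbaki, *Algebra* II §5 no. 4).
[cite: BourbakiAlgebraI1989, Ch. II §5 no. 4] [cite: Deligne1970, I.1] -/
def dualRatIsoApp (x : FundamentalGroupoid S) : (D.VZ.dual.baseChange (Int.castRingHom ℚ)).obj x ≅ D.V.dual.obj x :=
  haveI : Module.Free ℤ (D.VZ.obj x) := D.free x.as
  haveI : Module.Finite ℤ (D.VZ.obj x) := D.finite x.as
  (D.isBaseChange_toRatLinear x).toDualBaseChange.toModuleIso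

/-- **`(1 ⊗ φ)(toRat u) = φ(u)`**: the comparison evaluates an integral functional on an integral vector integrally.
[cite: BourbakiAlgebraI1989, Ch. II §5 no. 4] -/
theorem dualRatIsoApp_hom_one_tmul_apply (x : FundamentalGroupoid S) (φ : Module.Dual ℤ (D.VZ.obj x)) (u : D.VZ.obj x) :
    (show Module.Dual ℚ (D.V.obj x) from (D.dualRatIsoApp x).hom ((1 : ℚ) ⊗ₜ[ℤ,Int.castRingHom ℚ] (φ : D.VZ.dual.obj x))) (D.toRat x.as u) =
      ((φ u : ℤ) : ℚ) := by
  haveI : Module.Free ℤ (D.VZ.obj x) := D.free x.as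
  haveI : Module.Finite ℤ (D.VZ.obj x) := D.finite x.as
  change (D.isBaseChange_toRatLinear x).toDualBaseChange ((1 : ℚ) ⊗ₜ[ℤ] φ) (D.toRatLinear x u) = _
  rw [IsBaseChange.toDualBaseChange_tmul, one_mul]
  rfl

/-- **Naturality of the comparison** along `g : x ⟶ y` in `Π₁(S)`: both ways round, `1 ⊗ φ ↦` the functional `toRat_y v ↦ φ((g⁻¹)_* v)` on the
`ℚ`-spanning image of `V_ℤ,y` (naturality of `toRat`, `map_hom_toRat`). [cite: Deligne1970, I.1] [cite: Schmid1973, §2] -/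
theorem dualRatIsoApp_naturality {x y : FundamentalGroupoid S} (g : x ⟶ y) :
    ((D.VZ.dual.baseChange (Int.castRingHom ℚ)).map g ≫ (D.dualRatIsoApp y).hom) = (D.dualRatIsoApp x).hom ≫ D.V.dual.map g := by
  haveI : Module.Free ℤ (D.VZ.obj x) := D.free x.as
  haveI : Module.Finite ℤ (D.VZ.obj x) := D.finite x.as
  haveI : Module.Free ℤ (D.VZ.obj y) := D.free y.as
  haveI : Module.Finite ℤ (D.VZ.obj y) := D.finite y.as
  apply ModuleCat.ExtendScalars.hom_ext
  intro φ
  change (D.isBaseChange_toRatLinear y).toDualBaseChange ((1 : ℚ) ⊗ₜ[ℤ] (D.VZ.map (Groupoid.inv g)).hom.dualMap φ) =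
    ((D.isBaseChange_toRatLinear x).toDualBaseChange ((1 : ℚ) ⊗ₜ[ℤ] (φ : Module.Dual ℤ (D.VZ.obj x)))) ∘ₗ (D.V.map (Groupoid.inv g)).hom
  refine (D.isBaseChange_toRatLinear y).algHom_ext _ _ fun v => ?_
  have hv : (D.V.map (Groupoid.inv g)).hom (D.toRatLinear y v) = D.toRatLinear x ((D.VZ.map (Groupoid.inv g)).hom v) :=
    D.map_hom_toRat (Groupoid.inv g) v
  rw [IsBaseChange.toDualBaseChange_tmul, LinearMap.comp_apply, hv, IsBaseChange.toDualBaseChange_tmul]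
  rfl

/-- **The comparison isomorphism of local systems `V_ℤ^∨ ⊗ ℚ ≅ V^∨`** (natural in the point of `Π₁(S)`). [cite: Deligne1970, I.1] [cite: Schmid1973, §2] -/
def dualRatIso : D.VZ.dual.baseChange (Int.castRingHom ℚ) ≅ D.V.dual :=
  NatIso.ofComponents (fun x => D.dualRatIsoApp x) fun g => D.dualRatIsoApp_naturality g

/-! ## §4 The dual VHS datum -/

/-- Invariance of the inverse form under an isometry between two polarized Hodge structures, in contragredient form: for `T : V₂ → V₁` with
`Q₁(Tv, Tw) = Q₂(v, w)` and a left inverse `T'` (`T(T'v) = v`), `Q₂^∨(φ ∘ T, ψ ∘ T) = Q₁^∨(φ, ψ)` — because `θ₂⁻¹(φ ∘ T) = T'(θ₁⁻¹ φ)`.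
[cite: Moonen2017FamiliesMotives, §2.1 (p. 3)] -/
theorem dualForm_comp_eq {V₁ V₂ : Type} [AddCommGroup V₁] [Module ℚ V₁] [Module.Finite ℚ V₁] [AddCommGroup V₂] [Module ℚ V₂]
    [Module.Finite ℚ V₂] {n : ℤ} {H₁ : HodgeStructure V₁ n} {H₂ : HodgeStructure V₂ n} (Q₁ : HodgeStructure.Polarization H₁)
    (Q₂ : HodgeStructure.Polarization H₂) (T : V₂ →ₗ[ℚ] V₁) (T' : V₁ →ₗ[ℚ] V₂) (hTT' : ∀ v, T (T' v) = v)
    (hT : ∀ v w, Q₁.form (T v) (T w) = Q₂.form v w) (φ ψ : Module.Dual ℚ V₁) :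
    Q₂.dualForm (φ ∘ₗ T) (ψ ∘ₗ T) = Q₁.dualForm φ ψ := by
  -- `θ₂⁻¹ (χ ∘ T) = T' (θ₁⁻¹ χ)`
  have key : ∀ χ : Module.Dual ℚ V₁, Q₂.toDualEquiv.symm (χ ∘ₗ T) = T' (Q₁.toDualEquiv.symm χ) := by
    intro χ
    apply Q₂.toDualEquiv.injective
    rw [LinearEquiv.apply_symm_apply]
    ext w
    rw [Q₂.toDualEquiv_apply, LinearMap.comp_apply, ← hT, hTT', Q₁.form_toDualEquiv_symm]
  rw [Q₂.dualForm_apply, Q₁.dualForm_apply, key, key, ← hT, hTT', hTT']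

/-- **The dual `D^∨` of the data of a polarized variation of Hodge structure** of weight `k` on `S` (Griffiths 1970 §1 ∕ Schmid 1973 §2: variations
are stable under duals): integral and rational local systems `V_ℤ^∨`, `V^∨` with the contragredient transports (§1), comparison `V^∨ ≅ V_ℤ^∨ ⊗ ℚ`
(§3), on each fibre the dual Hodge structure of weight `−k` (`HodgeStructure.dual`, Hodge II 1.1.6–1.1.7) polarized by the inverse form `Q^∨`
(`Polarization.dual`, Moonen §2.1), flat since the transports of `D` are isometries (`dualForm_comp_eq`); the integral fibres `Hom(V_ℤ,s, ℤ)` are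
finitely generated free. [cite: Griffiths1970, §1] [cite: Schmid1973, §2] [cite: DeligneHodgeII1971, 1.1.6–1.1.7 and 2.1.15] [cite: Moonen2017FamiliesMotives, §2.1] -/
def dual : VHSData S (-k) where
  VZ := D.VZ.dual
  V := D.V.dual
  ratIso := D.dualRatIso.symm
  hodge s :=
    haveI : HodgeTensorFacts.{0, 0} := hodgeTensorFacts_holds
    haveI : Module.Finite ℚ (D.V.fiber s) := D.finite_fiber s
    (D.hodge s).dual
  form s :=
    haveI : HodgeTensorFacts.{0, 0} := hodgeTensorFacts_holds
    haveI : Module.Finite ℚ (D.V.fiber s) := D.finite_fiber s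
    (D.form s).dual
  transport_form s t γ x y := by
    haveI : HodgeTensorFacts.{0, 0} := hodgeTensorFacts_holds
    haveI : Module.Finite ℚ (D.V.fiber s) := D.finite_fiber s
    haveI : Module.Finite ℚ (D.V.fiber t) := D.finite_fiber t
    change (D.form t).dual.form (x ∘ₗ D.V.transport γ.symm) (y ∘ₗ D.V.transport γ.symm) = (D.form s).dual.form x y
    rw [HodgeStructure.Polarization.dual_form, HodgeStructure.Polarization.dual_form]
    exact dualForm_comp_eq (D.form s) (D.form t) (D.V.transport γ.symm) (D.V.transport γ) (D.V.transport_symm_apply_transport γ)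
      (D.transport_form t s γ.symm) x y
  finite_free s := by
    haveI := D.finite s
    haveI := D.free s
    change Module.Finite ℤ (Module.Dual ℤ (D.VZ.fiber s)) ∧ Module.Free ℤ (Module.Dual ℤ (D.VZ.fiber s))
    exact ⟨inferInstance, inferInstance⟩

/-! ## §5 API -/

/-- The integral local system of `D^∨` is `V_ℤ^∨`. [cite: Deligne1970, I.1] -/
@[simp] theorem dual_VZ : D.dual.VZ = D.VZ.dual := rfl

/-- The rational local system of `D^∨` is `V^∨`. [cite: Deligne1970, I.1] -/
@[simp] theorem dual_V : D.dual.V = D.V.dual := rfl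

/-- The Hodge structure of `D^∨` at `s` is the dual Hodge structure. [cite: DeligneHodgeII1971, 1.1.6–1.1.7] -/
theorem dual_hodge [HodgeTensorFacts.{0, 0}] (s : S) :
    D.dual.hodge s = (haveI : Module.Finite ℚ (D.V.fiber s) := D.finite_fiber s; (D.hodge s).dual) := rfl

/-- The polarization form of `D^∨` at `s` is the inverse form `Q_s^∨(φ, ψ) = Q_s(θ⁻¹ φ, θ⁻¹ ψ)`. [cite: Moonen2017FamiliesMotives, §2.1 (p. 3)] -/
theorem dual_form_form (s : S) (φ ψ : Module.Dual ℚ (D.V.fiber s)) :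
    (D.dual.form s).form φ ψ =
      (haveI : Module.Finite ℚ (D.V.fiber s) := D.finite_fiber s
       (D.form s).form ((D.form s).toDualEquiv.symm φ) ((D.form s).toDualEquiv.symm ψ)) := rfl

/-- Rational transport of `D^∨`: `γ_* φ = φ ∘ γ⁻¹_*`. [cite: Deligne1970, I.1] -/
theorem dual_V_transport_apply {s t : S} (γ : Path.Homotopic.Quotient s t) (φ : Module.Dual ℚ (D.V.fiber s)) :
    D.dual.V.transport γ φ = φ ∘ₗ D.V.transport γ.symm := rfl

/-- Integral transport of `D^∨`: `γ_* φ = φ ∘ γ⁻¹_*`. [cite: Deligne1970, I.1] -/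
theorem dual_VZ_transport_apply {s t : S} (γ : Path.Homotopic.Quotient s t) (φ : Module.Dual ℤ (D.VZ.fiber s)) :
    D.dual.VZ.transport γ φ = φ ∘ₗ D.VZ.transport γ.symm := rfl

/-- **`toRat^∨(φ)(toRat u) = φ(u)`**: the comparison `V_ℤ,s^∨ → V_s^∨` of `D^∨` evaluates an integral functional on an integral vector integrally.
[cite: BourbakiAlgebraI1989, Ch. II §5 no. 4] [cite: Schmid1973, §2] -/
theorem dual_toRat_apply (s : S) (φ : Module.Dual ℤ (D.VZ.fiber s)) (u : D.VZ.fiber s) :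
    (show Module.Dual ℚ (D.V.fiber s) from D.dual.toRat s (φ : D.dual.VZ.fiber s)) (D.toRat s u) = ((φ u : ℤ) : ℚ) :=
  D.dualRatIsoApp_hom_one_tmul_apply ⟨s⟩ φ u

/-- Pull-back commutes with duals on fibres, transports, Hodge structures and forms (both read at `f s'`); stated on `toRat`. [cite: Deligne1970, I.1] -/
theorem comap_dual_toRat {S' : Type} [TopologicalSpace S'] (f : C(S', S)) (s' : S') :
    (D.comap f).dual.toRat s' = (D.dual.comap f).toRat s' := rfl

end VHSData

end Literature.AlgebraicGeometry.Motives

end
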